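import Summits.Ventures.LatticeQCDFlow.Scoring.ScorerTauIntCLT
import Summits.Ventures.LatticeQCDFlow.Scoring.MadrasSokalDataWindowCLT

/-!
# WHAT THE SCORER PRINTS, AS IT PRINTS IT: the `τ_int` CLT for the centred `1/(N−t)` statistic read at scorer B's data-chosen window

HONEST FRAMING: exact (Metropolis-corrected) sampling algorithms for lattice gauge theory;
figures of merit are autocorrelation/cost numbers at stated couplings and volumes; no
continuum-physics claim.

Venture `LatticeQCDFlow` (cell pub-lqcd), sub-topic `Scoring`; FANOUT row 16 (`su2-base`), GEN-8.
NEW WORK of the cell — the last docking of GEN-8's line: `ScorerTauIntCLT` (the fixed-window CLT for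
the scorers' EXACT statistic `tauIntWindow (Γ̂_c(·)/Γ̂_c(0)) W`, GEN-6 `acovHatC`) × `MadrasSokalDataWindow`
(transfer at a strict crossing) × `MadrasSokalWindowSelector` (scorer B's `ms_window`), with the
per-window consistency of the CENTRED statistic proved here from `MeanSubtractionCLT` and the Z-free
consistency of `MadrasSokalDataWindowCLT`.  No definition; nothing cited as a fact.

## Contents (`ξ` i.i.d., `X_i = F(ξ_i..ξ_{i+m})`, `X_0 ∈ L²`, `μ = E X_0`, centred lag products square integrable, `γ(t) = E[(X_0−μ)(X_t−μ)]`)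

* §1 `tendstoInMeasure_of_sqrt_mul_tendstoInMeasure` — `√N D_N → 0` in measure ⇒ `D_N → 0`.
* §2 **`tendstoInMeasure_acovHatC_blockFactor`** — `Γ̂_c(t) → γ(t)` in probability at every lag;
  **`tendstoInMeasure_tauIntWindowC_blockFactor`** — `tauIntWindow (Γ̂_c(·)/Γ̂_c(0)) W → tauIntWindow (γ(·)/γ(0)) W`
  in probability at every window (`γ(0) ≠ 0`).
* §3 `measurable_tauIntWindow_acovHatC`, `measurable_msWindowSel_acovHatC`.
* §4 **`tendstoInDistribution_tauIntWindowC_at_msWindowSel`** — THE STATEMENT: at a strict population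
  crossing `w ≤ Wmax` (`c > 0`), with `Ŵ_N = msWindowSel c Wmax (τ̂^c_N(·))` computed from the SAME
  centred statistic, `√N (τ̂^c_N(Ŵ_N) − τ_{Ŵ_N}) ⇒ ⟪∇τ(γ_vec), Z⟫ = N(0, ℓᵀ Σ_c ℓ)`;
  `tendsto_measure_msWindowSel_acovHatC_ne` — `P(Ŵ_N ≠ w) → 0`.

NOT CLAIMED: tangential crossings; `w > Wmax`; Markov-chain data; numbers.
-/

noncomputable section

open MeasureTheory ProbabilityTheory Filter Finset WithLp
open scoped Topology ENNReal RealInnerProductSpace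

namespace Summit.Ventures.LatticeQCDFlow.Scoring

/-! ## §1 A `√N`-null sequence is null -/

section Tools

variable {Ω : Type*} [MeasurableSpace Ω] {P : Measure Ω}

/-- If `√N · D_N → 0` in measure then `D_N → 0` in measure (`|D_N| ≤ |√N D_N|` once `N ≥ 1`). -/
theorem tendstoInMeasure_of_sqrt_mul_tendstoInMeasure {D : ℕ → Ω → ℝ}
    (h : TendstoInMeasure P (fun (N : ℕ) ω => Real.sqrt N * D N ω) atTop fun _ => 0) :
    TendstoInMeasure P D atTop fun _ => 0 := by
  rw [tendstoInMeasure_iff_norm] at h ⊢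
  intro ε hε
  refine tendsto_of_tendsto_of_tendsto_of_le_of_le' tendsto_const_nhds (h ε hε)
    (Eventually.of_forall fun _ => bot_le) ?_
  filter_upwards [eventually_ge_atTop 1] with N hN
  refine measure_mono fun ω hω => ?_
  simp only [sub_zero, Real.norm_eq_abs, Set.mem_setOf_eq] at hω ⊢
  have h1 : (1 : ℝ) ≤ Real.sqrt N := by
    rw [Real.one_le_sqrt]; exact_mod_cast hN
  calc ε ≤ |D N ω| := hω
    _ = 1 * |D N ω| := (one_mul _).symm
    _ ≤ Real.sqrt N * |D N ω| := mul_le_mul_of_nonneg_right h1 (abs_nonneg _)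
    _ = |Real.sqrt N * D N ω| := by
        rw [abs_mul, abs_of_nonneg (Real.sqrt_nonneg _)]

end Tools

/-! ## §2 Consistency of the centred statistic, lag by lag and window by window -/

section Consistency

variable {Ω : Type*} [MeasurableSpace Ω] {P : Measure Ω} [IsProbabilityMeasure P]
variable {S : Type*} [MeasurableSpace S] {ξ : ℕ → Ω → S} {m : ℕ} {F : (Fin (m + 1) → S) → ℝ}

/-- **`Γ̂_c(t) → γ(t)` in probability** for a block-factor process: the centred `1/(N−t)` estimator is
`o_p(N^{-1/2})`-close to the known-mean statistic of `Y = X − μ` (`MeanSubtractionCLT`), which is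
consistent by the scalar per-lag CLT (`MadrasSokalDataWindowCLT.tendstoInMeasure_acovHat_blockFactor`). -/
theorem tendstoInMeasure_acovHatC_blockFactor (hξ : ∀ i, Measurable (ξ i)) (hind : iIndepFun ξ P)
    (hid : ∀ i, IdentDistrib (ξ i) (ξ 0) P P) (hF : Measurable F)
    (h2 : MemLp (blockFactor F ξ 0) 2 P)
    (h4c : ∀ t, MemLp (fun ω => (blockFactor F ξ 0 ω - P[blockFactor F ξ 0])
      * (blockFactor F ξ t ω - P[blockFactor F ξ 0])) 2 P) (t : ℕ) :
    TendstoInMeasure P (fun N => acovHatC (blockFactor F ξ) N t) atTop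
      fun _ => P[fun ω => (blockFactor F ξ 0 ω - P[blockFactor F ξ 0])
        * (blockFactor F ξ t ω - P[blockFactor F ξ 0])] := by
  set μ : ℝ := P[blockFactor F ξ 0] with hμ
  set Fc : (Fin (m + 1) → S) → ℝ := fun w => F w - μ with hFc
  have hFc_m : Measurable Fc := hF.sub_const _
  have hY : (fun i ω => blockFactor F ξ i ω - μ) = blockFactor Fc ξ := rfl
  -- the difference to the known-mean statistic of `Y` is `o_p(1)`
  have hdiff : TendstoInMeasure P (fun (N : ℕ) ω => acovHatC (blockFactor F ξ) N t ω
      - acovHat (blockFactor Fc ξ) N t ω) atTop fun _ => 0 := by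
    have h := tendstoInMeasure_sqrt_mul_acovHatC_sub_acovHat_blockFactor hξ hind hid hF h2 t
    rw [← hμ, hY] at h
    exact tendstoInMeasure_of_sqrt_mul_tendstoInMeasure h
  -- and the latter is consistent
  have hcons : TendstoInMeasure P (fun N => acovHat (blockFactor Fc ξ) N t) atTop
      fun _ => P[fun ω => blockFactor Fc ξ 0 ω * blockFactor Fc ξ t ω] :=
    tendstoInMeasure_acovHat_blockFactor hξ hind hid hFc_m h4c t
  have h := tendstoInMeasure_add_lim hdiff hcons
  simp only [zero_add, sub_add_cancel] at h
  exact h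

/-- **`tauIntWindow (Γ̂_c(·)/Γ̂_c(0)) W → tauIntWindow (γ(·)/γ(0)) W` in probability at every window**
(`γ(0) ≠ 0`; induction on `W`). -/
theorem tendstoInMeasure_tauIntWindowC_blockFactor (hξ : ∀ i, Measurable (ξ i)) (hind : iIndepFun ξ P)
    (hid : ∀ i, IdentDistrib (ξ i) (ξ 0) P P) (hF : Measurable F)
    (h2 : MemLp (blockFactor F ξ 0) 2 P)
    (h4c : ∀ t, MemLp (fun ω => (blockFactor F ξ 0 ω - P[blockFactor F ξ 0])
      * (blockFactor F ξ t ω - P[blockFactor F ξ 0])) 2 P)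
    (hσ : P[fun ω => (blockFactor F ξ 0 ω - P[blockFactor F ξ 0])
      * (blockFactor F ξ 0 ω - P[blockFactor F ξ 0])] ≠ 0) (W : ℕ) :
    TendstoInMeasure P (fun (N : ℕ) ω => tauIntWindow (fun t => acovHatC (blockFactor F ξ) N t ω
        / acovHatC (blockFactor F ξ) N 0 ω) W) atTop
      fun _ => tauIntWindow (fun t => P[fun ω => (blockFactor F ξ 0 ω - P[blockFactor F ξ 0])
          * (blockFactor F ξ t ω - P[blockFactor F ξ 0])]
        / P[fun ω => (blockFactor F ξ 0 ω - P[blockFactor F ξ 0])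
          * (blockFactor F ξ 0 ω - P[blockFactor F ξ 0])]) W := by
  induction W with
  | zero =>
    simp only [tauIntWindow, sum_range_zero, add_zero]
    exact tendstoInMeasure_const_real (P := P) (1 / 2 : ℝ)
  | succ W ih =>
    have hρ := tendstoInMeasure_div_lim hσ
      (tendstoInMeasure_acovHatC_blockFactor hξ hind hid hF h2 h4c (W + 1))
      (tendstoInMeasure_acovHatC_blockFactor hξ hind hid hF h2 h4c 0)
    have h := tendstoInMeasure_add_lim ih hρ
    simpa only [tauIntWindow, sum_range_succ, add_assoc] using h

end Consistency

/-! ## §3 Measurability -/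

section Measurability

variable {Ω : Type*} [MeasurableSpace Ω]
variable {S : Type*} [MeasurableSpace S] {ξ : ℕ → Ω → S} {m : ℕ} {F : (Fin (m + 1) → S) → ℝ}

/-- The centred windowed estimates are measurable. -/
theorem measurable_tauIntWindow_acovHatC (hξ : ∀ i, Measurable (ξ i)) (hF : Measurable F) (N W : ℕ) :
    Measurable fun ω => tauIntWindow (fun t => acovHatC (blockFactor F ξ) N t ω
      / acovHatC (blockFactor F ξ) N 0 ω) W := by
  simp only [tauIntWindow]
  exact measurable_const.add (Finset.measurable_sum _ fun t _ =>
    (measurable_acovHatC (fun i => measurable_blockFactor hξ hF i) N _).div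
      (measurable_acovHatC (fun i => measurable_blockFactor hξ hF i) N 0))

/-- Scorer B's window computed from the centred estimates is a measurable function of the data. -/
theorem measurable_msWindowSel_acovHatC (hξ : ∀ i, Measurable (ξ i)) (hF : Measurable F) (c : ℝ)
    (Wmax N : ℕ) :
    Measurable fun ω => msWindowSel c Wmax (fun W => tauIntWindow (fun t =>
      acovHatC (blockFactor F ξ) N t ω / acovHatC (blockFactor F ξ) N 0 ω) W) :=
  measurable_msWindowSel (fun W => measurable_tauIntWindow_acovHatC hξ hF N W) c Wmax

end Measurability

/-! ## §4 The statement: the scorer's statistic, at the scorer's window -/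

section AtWindow

variable {Ω : Type*} [MeasurableSpace Ω] {P : Measure Ω} [IsProbabilityMeasure P]
variable {Ω' : Type*} [MeasurableSpace Ω'] {P' : Measure Ω'} [IsProbabilityMeasure P']
variable {S : Type*} [MeasurableSpace S] {ξ : ℕ → Ω → S} {m : ℕ} {F : (Fin (m + 1) → S) → ℝ}

/-- **`P(Ŵ_N ≠ w) → 0`** for scorer B's window computed from the centred estimates. -/
theorem tendsto_measure_msWindowSel_acovHatC_ne (hξ : ∀ i, Measurable (ξ i)) (hind : iIndepFun ξ P)
    (hid : ∀ i, IdentDistrib (ξ i) (ξ 0) P P) (hF : Measurable F)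
    (h2 : MemLp (blockFactor F ξ 0) 2 P)
    (h4c : ∀ t, MemLp (fun ω => (blockFactor F ξ 0 ω - P[blockFactor F ξ 0])
      * (blockFactor F ξ t ω - P[blockFactor F ξ 0])) 2 P)
    (hσ : P[fun ω => (blockFactor F ξ 0 ω - P[blockFactor F ξ 0])
      * (blockFactor F ξ 0 ω - P[blockFactor F ξ 0])] ≠ 0) {c : ℝ} (hc : 0 < c)
    {w Wmax : ℕ} (hwle : w ≤ Wmax)
    (hw : IsStrictMSWindow c (fun W => tauIntWindow (fun t =>
      P[fun ω => (blockFactor F ξ 0 ω - P[blockFactor F ξ 0]) * (blockFactor F ξ t ω - P[blockFactor F ξ 0])]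
        / P[fun ω => (blockFactor F ξ 0 ω - P[blockFactor F ξ 0])
          * (blockFactor F ξ 0 ω - P[blockFactor F ξ 0])]) W) w) :
    Tendsto (fun N : ℕ => P {ω | msWindowSel c Wmax (fun W => tauIntWindow (fun t =>
        acovHatC (blockFactor F ξ) N t ω / acovHatC (blockFactor F ξ) N 0 ω) W) ≠ w}) atTop (𝓝 0) := by
  set τhat : ℕ → ℕ → Ω → ℝ := fun N W ω => tauIntWindow (fun t => acovHatC (blockFactor F ξ) N t ω
      / acovHatC (blockFactor F ξ) N 0 ω) W with hτhat
  set τW : ℕ → ℝ := fun W => tauIntWindow (fun t =>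
      P[fun ω => (blockFactor F ξ 0 ω - P[blockFactor F ξ 0]) * (blockFactor F ξ t ω - P[blockFactor F ξ 0])]
        / P[fun ω => (blockFactor F ξ 0 ω - P[blockFactor F ξ 0])
          * (blockFactor F ξ 0 ω - P[blockFactor F ξ 0])]) W with hτW
  have hconv : ∀ W, 1 ≤ W → W ≤ w → TendstoInMeasure P (fun N => τhat N W) atTop fun _ => τW W :=
    fun W _ _ => tendstoInMeasure_tauIntWindowC_blockFactor hξ hind hid hF h2 h4c hσ W
  have hsel : ∀ N ω, IsMSWindow c (fun W => τhat N W ω) w →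
      msWindowSel c Wmax (fun W => τhat N W ω) = w :=
    fun _ _ h => msWindowSel_eq_of_isMSWindow h hwle
  exact tendsto_measure_msWindowSel_ne hc hw hconv hsel

/-- **WHAT THE SCORER PRINTS, AS IT PRINTS IT.**  `ξ` i.i.d., `X_i = F(ξ_i, …, ξ_{i+m})`, `X_0 ∈ L²`,
centred lag products square integrable, `γ(0) = Var X_0 ≠ 0`; the population curve
`W ↦ τ_W = tauIntWindow (γ(·)/γ(0)) W` has a STRICT Madras–Sokal window `w ≤ Wmax` at the scorer's
`c > 0`; `Z` the Gaussian limit vector with the CENTRED-process covariance `Σ_c` at window `w`.  With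
`τ̂^c_N(W) = tauIntWindow (Γ̂_c(·)/Γ̂_c(0)) W` (mean-subtracted, `1/(N−t)`, as both scorers compute it)
and `Ŵ_N = msWindowSel c Wmax (τ̂^c_N(·))` (scorer B's `ms_window` on the same curve):
`√N (τ̂^c_N(Ŵ_N) − τ_{Ŵ_N}) ⇒ ⟪∇τ(γ_vec), Z⟫ = N(0, ℓᵀ Σ_c ℓ)`. -/
theorem tendstoInDistribution_tauIntWindowC_at_msWindowSel (hξ : ∀ i, Measurable (ξ i))
    (hind : iIndepFun ξ P) (hid : ∀ i, IdentDistrib (ξ i) (ξ 0) P P) (hF : Measurable F)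
    (h2 : MemLp (blockFactor F ξ 0) 2 P)
    (h4c : ∀ t, MemLp (fun ω => (blockFactor F ξ 0 ω - P[blockFactor F ξ 0])
      * (blockFactor F ξ t ω - P[blockFactor F ξ 0])) 2 P)
    (hσ : P[fun ω => (blockFactor F ξ 0 ω - P[blockFactor F ξ 0])
      * (blockFactor F ξ 0 ω - P[blockFactor F ξ 0])] ≠ 0) {c : ℝ} (hc : 0 < c)
    {w Wmax : ℕ} (hwle : w ≤ Wmax)
    (hw : IsStrictMSWindow c (fun W => tauIntWindow (fun t =>
      P[fun ω => (blockFactor F ξ 0 ω - P[blockFactor F ξ 0]) * (blockFactor F ξ t ω - P[blockFactor F ξ 0])]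
        / P[fun ω => (blockFactor F ξ 0 ω - P[blockFactor F ξ 0])
          * (blockFactor F ξ 0 ω - P[blockFactor F ξ 0])]) W) w)
    {Z : Ω' → EuclideanSpace ℝ (Fin (w + 1))} (hZm : AEMeasurable Z P')
    (hZ : ∀ a : EuclideanSpace ℝ (Fin (w + 1)), HasLaw (fun ω' => ⟪a, Z ω'⟫) (gaussianReal 0
      (∑ s : Fin (w + 1), ∑ t : Fin (w + 1), a s * a t
        * lagProdACov (fun i ω => blockFactor F ξ i ω - P[blockFactor F ξ 0]) P (m + w) s t).toNNReal)
      P') :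
    TendstoInDistribution
      (fun (N : ℕ) ω =>
        Real.sqrt N * (tauIntWindow (fun t => acovHatC (blockFactor F ξ) N t ω
            / acovHatC (blockFactor F ξ) N 0 ω)
            (msWindowSel c Wmax (fun W => tauIntWindow (fun t =>
              acovHatC (blockFactor F ξ) N t ω / acovHatC (blockFactor F ξ) N 0 ω) W))
          - tauIntWindow (fun t =>
              P[fun ω => (blockFactor F ξ 0 ω - P[blockFactor F ξ 0])
                * (blockFactor F ξ t ω - P[blockFactor F ξ 0])]
              / P[fun ω => (blockFactor F ξ 0 ω - P[blockFactor F ξ 0])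
                * (blockFactor F ξ 0 ω - P[blockFactor F ξ 0])])
            (msWindowSel c Wmax (fun W => tauIntWindow (fun t =>
              acovHatC (blockFactor F ξ) N t ω / acovHatC (blockFactor F ξ) N 0 ω) W))))
      atTop (fun ω' => ⟪tauHatGrad w (toLp 2 fun t : Fin (w + 1) =>
        P[fun ω => (blockFactor F ξ 0 ω - P[blockFactor F ξ 0])
          * (blockFactor F ξ t ω - P[blockFactor F ξ 0])]), Z ω'⟫) (fun _ => P) P' := by
  set τhat : ℕ → ℕ → Ω → ℝ := fun N W ω => tauIntWindow (fun t => acovHatC (blockFactor F ξ) N t ω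
      / acovHatC (blockFactor F ξ) N 0 ω) W with hτhat
  set τW : ℕ → ℝ := fun W => tauIntWindow (fun t =>
      P[fun ω => (blockFactor F ξ 0 ω - P[blockFactor F ξ 0]) * (blockFactor F ξ t ω - P[blockFactor F ξ 0])]
        / P[fun ω => (blockFactor F ξ 0 ω - P[blockFactor F ξ 0])
          * (blockFactor F ξ 0 ω - P[blockFactor F ξ 0])]) W with hτW
  have hclt : TendstoInDistribution (fun (N : ℕ) ω => Real.sqrt N * (τhat N w ω - τW w)) atTop
      (fun ω' => ⟪tauHatGrad w (toLp 2 fun t : Fin (w + 1) =>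
        P[fun ω => (blockFactor F ξ 0 ω - P[blockFactor F ξ 0])
          * (blockFactor F ξ t ω - P[blockFactor F ξ 0])]), Z ω'⟫) (fun _ => P) P' :=
    tendstoInDistribution_tauIntWindow_acovHatC hξ hind hid hF h2 h4c w hσ hZm hZ
  have hτm : ∀ N W, Measurable (τhat N W) := fun N W => measurable_tauIntWindow_acovHatC hξ hF N W
  have hWm : ∀ N, Measurable fun ω => msWindowSel c Wmax (fun W => τhat N W ω) :=
    fun N => measurable_msWindowSel (fun W => hτm N W) c Wmax
  have hconv : ∀ W, 1 ≤ W → W ≤ w → TendstoInMeasure P (fun N => τhat N W) atTop fun _ => τW W :=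
    fun W _ _ => tendstoInMeasure_tauIntWindowC_blockFactor hξ hind hid hF h2 h4c hσ W
  have hsel : ∀ N ω, IsMSWindow c (fun W => τhat N W ω) w →
      msWindowSel c Wmax (fun W => τhat N W ω) = w :=
    fun _ _ h => msWindowSel_eq_of_isMSWindow h hwle
  exact tendstoInDistribution_tauHat_at_msWindow hclt hτm hWm hc hw hconv hsel

end AtWindow

end Summit.Ventures.LatticeQCDFlow.Scoring

end
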